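import Summits.NavierStokesRegularity.NavierStokesRegularity.Theorems.StrainDoorsEulerAndTangentDoor
import HarnessLib

/-!
# Strain doors, PART G — RECENTRING THE VORTICITY NUMBER OF A GENERAL TYPE-I SOLUTION

`Summit.NavierStokesRegularity.NavierStokesRegularity.Theorems.StrainDoors` (continued). First piece of the
proof programme for the tangent-flow door D14 (`TypeIVorticityTangentRecord`, PART F): everything KNSS's
recentring argument (arXiv:0709.3599, p. 5: «points `x_k` with `u(x_k) → sup`, recentre, pass to a limit by
compactness, the limit attains the supremum») needs BEFORE the limit is taken, for the vorticity number
`W(s,y) = (0 − s)|ω(s,y)|` of an arbitrary (not self-similar) classical Type-I solution on `(−∞,0) × ℝ³`.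

* §1 Scaling identities for the slices of `nsRescale λ u` (`∇`, `curl`, the two numbers are scale invariant).
* §2 `typeI_class_nsRescale` — the Type-I class `{classical on t < 0, ν = 1, f = 0, |u| ≤ C₀/(|x|+√−t)}` is
  invariant under `u ↦ λu(λ²·, λ·)` (tree: `IsClassicalNSSolutionOn.nsRescale_holds`, `HasTypeIDecay.nsRescale`).
* §3 `typeI_grad_clock_bound` — **`(0 − t)|∇u(t,x)| ≤ K(C₀)`** for every member, all `t < 0`, `x` (KNSS §4
  Lipschitz bound at `t = −1/4`, transported to every time by §2).
* §4 `typeI_grad_decay_unit_time` — uniform-in-the-class far-field decay of `∇u(−1,·)` (Type-I decay + the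
  uniform Hessian bound + Landau), and its scale-invariant form `typeI_gradNumber_far_decay`:
  **`(0 − s)|∇u(s,y)| ≤ η` once `|y| ≥ R(C₀,η)√(0 − s)`**.
* §5 `typeI_vorticityNumber_bound` (`W ≤ B(C₀)`) and the **near-record cone**
  `typeI_vorticity_nearRecord_cone`: `(0 − s)|ω(s,y)| ≥ η ⇒ |y| < R(C₀,η)√(0 − s)`.
* §6 ★★ `typeI_recentred_family` — for every member with `ω ≢ 0`: the vorticity number
  `W* = sup (0 − s)|ω| ∈ (0, ∞)` exists, and there are scales `λ_j > 0` and points `|z_j| < R` such that the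
  rescaled solutions `u_j = λ_j u(λ_j²·, λ_j·)` lie in the SAME class (same `C₀`, hence the same uniform
  `C^k` bounds), have the same number `W*`, and almost attain it at the fixed time `−1`:
  `W* − W*/(j+2) < |ω_j(−1, z_j)|`.  What remains for D14 is the limit `j → ∞` (R58+).

No self-similarity anywhere in this file. [folklore-typed; cite: KochNadirashviliSereginSverak2009, §2 p. 5, §4, §6]
-/

noncomputable section

open MeasureTheory Set Function Filter Metric Real InnerProductSpace
open _root_.Topology
open scoped ENNReal NNReal RealInnerProductSpace ContDiff Laplacian
open Literature.Analysis Literature.Analysis.FluidPDE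
open Literature.Analysis.FluidPDE.VorticityDirectionDynamics

set_option linter.unusedVariables false
set_option linter.unusedSectionVars false

namespace Summit.NavierStokesRegularity.NavierStokesRegularity.Theorems.StrainDoors

open Summit.NavierStokesRegularity.NavierStokesRegularity.Theorems.ArgmaxDoors

-- nested operator types (operator norm of `curlCLM`), as in PARTS B–D
set_option maxSynthPendingDepth 3

/-! ## §1 Scaling identities -/

/-- `∇(λu(λ²s, λ·))(y) = λ²·∇u(λ²s)(λy)`. [folklore] -/
theorem fderiv_nsRescale (c : ℝ) (u : ℝ → (EuclideanSpace ℝ (Fin 3)) → (EuclideanSpace ℝ (Fin 3)))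
    (s : ℝ) (y : EuclideanSpace ℝ (Fin 3)) :
    fderiv ℝ (nsRescale c u s) y = c ^ 2 • fderiv ℝ (u (c ^ 2 * s)) (c • y) := by
  rw [show nsRescale c u s = fun y => c • u (c ^ 2 * s) (c • y) from rfl]  -- (`nsRescale_slice`, `rfl`)
  exact fderiv_smul_comp_smul _ c y

/-- `curl(λu(λ²s, λ·))(y) = λ²·(curl u(λ²s))(λy)`. [folklore] -/
theorem curl_nsRescale (c : ℝ) (u : ℝ → (EuclideanSpace ℝ (Fin 3)) → (EuclideanSpace ℝ (Fin 3)))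
    (s : ℝ) (y : EuclideanSpace ℝ (Fin 3)) :
    curl (nsRescale c u s) y = c ^ 2 • curl (u (c ^ 2 * s)) (c • y) := by
  rw [curl_eq_curlCLM, curl_eq_curlCLM, fderiv_nsRescale, map_smul]

/-- **The gradient number is scale invariant**: `(0 − s)|∇u_λ(s,y)| = (0 − λ²s)|∇u(λ²s, λy)|`. [folklore] -/
theorem gradNumber_nsRescale (c : ℝ) (u : ℝ → (EuclideanSpace ℝ (Fin 3)) → (EuclideanSpace ℝ (Fin 3)))
    (s : ℝ) (y : EuclideanSpace ℝ (Fin 3)) :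
    (0 - s) * ‖fderiv ℝ (nsRescale c u s) y‖ = (0 - c ^ 2 * s) * ‖fderiv ℝ (u (c ^ 2 * s)) (c • y)‖ := by
  rw [fderiv_nsRescale, norm_smul, Real.norm_of_nonneg (sq_nonneg c)]
  ring

/-- **The vorticity number is scale invariant**: `(0 − s)|ω_λ(s,y)| = (0 − λ²s)|ω(λ²s, λy)|`. [folklore] -/
theorem vorticityNumber_nsRescale (c : ℝ) (u : ℝ → (EuclideanSpace ℝ (Fin 3)) → (EuclideanSpace ℝ (Fin 3)))
    (s : ℝ) (y : EuclideanSpace ℝ (Fin 3)) :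
    (0 - s) * ‖curl (nsRescale c u s) y‖ = (0 - c ^ 2 * s) * ‖curl (u (c ^ 2 * s)) (c • y)‖ := by
  rw [curl_nsRescale, norm_smul, Real.norm_of_nonneg (sq_nonneg c)]
  ring

/-! ## §2 The Type-I class is scale invariant -/

/-- **Scale invariance of the Type-I class.**  If `(u,p)` is a classical solution (`ν = 1`, `f = 0`) on `t < 0`
with `HasTypeIDecay C₀ u`, so is `(λu(λ²t, λx), λ²p(λ²t, λx))` for every `λ > 0`, with the same `C₀`.
[cite: Leray1934, §20; KochNadirashviliSereginSverak2009, §1 (1.6)] -/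
theorem typeI_class_nsRescale {C₀ c : ℝ} (hc : 0 < c)
    {u : ℝ → (EuclideanSpace ℝ (Fin 3)) → (EuclideanSpace ℝ (Fin 3))} {p : ℝ → (EuclideanSpace ℝ (Fin 3)) → ℝ}
    (hsol : IsClassicalNSSolutionOn (Iio 0) 1 0 u p) (hI : HasTypeIDecay C₀ u) :
    IsClassicalNSSolutionOn (Iio 0) 1 0 (nsRescale c u) (nsRescalePressure c p) ∧
      HasTypeIDecay C₀ (nsRescale c u) := by
  refine ⟨?_, hI.nsRescale hc⟩
  have key := IsClassicalNSSolutionOn.nsRescale_holds hsol hc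
  have hS : ((fun t : ℝ => c ^ 2 * t) ⁻¹' Iio (0 : ℝ)) = Iio 0 := by
    ext t
    simp only [mem_preimage, mem_Iio]
    constructor
    · intro h
      by_contra ht
      push Not at ht
      exact absurd h (not_lt.mpr (mul_nonneg (sq_nonneg c) ht))
    · intro h
      exact mul_neg_of_pos_of_neg (by positivity) h
  have hf : nsRescaleForce c (0 : ℝ → (EuclideanSpace ℝ (Fin 3)) → (EuclideanSpace ℝ (Fin 3))) = 0 := by
    funext t x
    simp [nsRescaleForce_apply]
  rw [hS, hf] at key
  exact key

/-! ## §3 The gradient clock bound -/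

/-- ★ **THE GRADIENT CLOCK BOUND FOR TYPE-I SOLUTIONS.**  For every `C₀ ≥ 0` there is `K ≥ 0` with
`(0 − t)·|∇u(t,x)| ≤ K` for every classical solution (`ν = 1`, `f = 0`) on `t < 0` with `HasTypeIDecay C₀ u`,
all `t < 0` and all `x` (KNSS §4 at `t = −1/4`, where `|∇u| ≤ 4K` uniformly in the class, transported to
time `t` by the rescaling `λ = 2√(0 − t)`).
[cite: KochNadirashviliSereginSverak2009, §4; ChaeWolf2017RemovingDSS, §3 (3.6)] -/
theorem typeI_grad_clock_bound {C₀ : ℝ} (hC₀ : 0 ≤ C₀) :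
    ∃ K : ℝ, 0 ≤ K ∧ ∀ {u : ℝ → (EuclideanSpace ℝ (Fin 3)) → (EuclideanSpace ℝ (Fin 3))}
      {p : ℝ → (EuclideanSpace ℝ (Fin 3)) → ℝ},
      IsClassicalNSSolutionOn (Iio 0) 1 0 u p → HasTypeIDecay C₀ u →
        ∀ t : ℝ, t < 0 → ∀ x : EuclideanSpace ℝ (Fin 3), (0 - t) * ‖fderiv ℝ (u t) x‖ ≤ K := by
  obtain ⟨K, L, hK, hL, hKL⟩ := ChaeWolf.exists_uniform_lipschitz hC₀
  refine ⟨K / 4, by positivity, ?_⟩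
  intro u p hsol hI t ht x
  obtain ⟨lam, hlam⟩ : ∃ lam : ℝ, lam = 2 * Real.sqrt (0 - t) := ⟨_, rfl⟩
  have hsq : 0 < Real.sqrt (0 - t) := Real.sqrt_pos.mpr (by linarith)
  have hlam0 : 0 < lam := by rw [hlam]; positivity
  have hlam2 : lam ^ 2 = 4 * (0 - t) := by
    rw [hlam, mul_pow, Real.sq_sqrt (by linarith)]; norm_num
  obtain ⟨hsol', hI'⟩ := typeI_class_nsRescale hlam0 hsol hI
  have hLip := (hKL hsol' hI').1 (-(1 / 4 : ℝ)) le_rfl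
  have hKnn : LipschitzWith (Real.toNNReal K) (nsRescale lam u (-(1 / 4 : ℝ))) :=
    LipschitzWith.of_dist_le_mul fun a b => by
      rw [dist_eq_norm, dist_eq_norm, Real.coe_toNNReal K hK]; exact hLip a b
  have hfd : ‖fderiv ℝ (nsRescale lam u (-(1 / 4 : ℝ))) (lam⁻¹ • x)‖ ≤ K := by
    have h := norm_fderiv_le_of_lipschitz ℝ hKnn (x₀ := lam⁻¹ • x)
    rwa [Real.coe_toNNReal K hK] at h
  have hts : lam ^ 2 * (-(1 / 4 : ℝ)) = t := by rw [hlam2]; ring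
  have hxs : lam • lam⁻¹ • x = x := by rw [smul_smul, mul_inv_cancel₀ hlam0.ne', one_smul]
  rw [fderiv_nsRescale, hts, hxs, norm_smul, Real.norm_of_nonneg (sq_nonneg _), hlam2] at hfd
  have : (0 - t) * ‖fderiv ℝ (u t) x‖ = 4 * (0 - t) * ‖fderiv ℝ (u t) x‖ / 4 := by ring
  rw [this]
  exact div_le_div_of_nonneg_right hfd (by norm_num)

/-! ## §4 Uniform far-field decay of the gradient -/

/-- **Uniform far-field gradient decay at time `−1`.**  For every `C₀ ≥ 0` and `ε > 0` there is `R` such that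
every classical Type-I solution of the class satisfies `|∇u(−1,x)| ≤ ε` for `|x| ≥ R` (Type-I decay
`|u(−1,·)| ≤ C₀/|x|`, the uniform Hessian bound `K₂(C₀)` and Landau's inequality on balls of radius
`ε/(K₂+1)`). [folklore; Landau 1913 via `norm_iteratedFDeriv_succ_le_of_bounds`] -/
theorem typeI_grad_decay_unit_time {C₀ : ℝ} (hC₀ : 0 ≤ C₀) :
    ∀ ε : ℝ, 0 < ε → ∃ R : ℝ, ∀ {u : ℝ → (EuclideanSpace ℝ (Fin 3)) → (EuclideanSpace ℝ (Fin 3))}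
      {p : ℝ → (EuclideanSpace ℝ (Fin 3)) → ℝ},
      IsClassicalNSSolutionOn (Iio 0) 1 0 u p → HasTypeIDecay C₀ u →
        ∀ x : EuclideanSpace ℝ (Fin 3), R ≤ ‖x‖ → ‖fderiv ℝ (u (-1)) x‖ ≤ ε := by
  obtain ⟨K₂, hK₂, hhess⟩ := exists_uniform_hessBound hC₀
  intro ε hε
  obtain ⟨s, hs⟩ : ∃ s : ℝ, s = ε / (2 * (K₂ + 1)) := ⟨_, rfl⟩
  have hs0 : 0 < s := by rw [hs]; positivity
  -- far-field velocity radius, uniform in the class: `|u(−1,y)| ≤ C₀/|y| ≤ ε s/4` for `|y| ≥ R₀`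
  obtain ⟨R₀, hR₀⟩ : ∃ R₀ : ℝ, R₀ = max 1 (C₀ / (ε * s / 4)) := ⟨_, rfl⟩
  have hvel : ∀ {u : ℝ → (EuclideanSpace ℝ (Fin 3)) → (EuclideanSpace ℝ (Fin 3))}, HasTypeIDecay C₀ u →
      ∀ y : EuclideanSpace ℝ (Fin 3), R₀ ≤ ‖y‖ → ‖u (-1) y‖ ≤ ε * s / 4 := by
    intro u hI y hy
    have hy1 : 1 ≤ ‖y‖ := (le_max_left _ _).trans (hR₀ ▸ hy)
    have hyC : C₀ / (ε * s / 4) ≤ ‖y‖ := (le_max_right _ _).trans (hR₀ ▸ hy)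
    have hεs : 0 < ε * s / 4 := by positivity
    refine (hI (-1) (by norm_num) y).trans ?_
    rw [neg_neg, Real.sqrt_one]
    calc C₀ / (‖y‖ + 1) ≤ C₀ / ‖y‖ := div_le_div_of_nonneg_left hC₀ (by linarith) (by linarith)
      _ ≤ ε * s / 4 := by
          rw [div_le_iff₀ (by linarith)]
          have := (div_le_iff₀ hεs).mp hyC
          linarith
  refine ⟨R₀ + 2 * s, fun {u} {p} hsol hI x hx => ?_⟩
  have ht0 : (-1 : ℝ) ∈ Iio (0 : ℝ) := by simp only [mem_Iio]; norm_num
  have hsm : ContDiff ℝ ∞ (u (-1)) := hsol.contDiff_velocity ht0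
  have h0 : ∀ y ∈ ball x (2 * s), ‖iteratedFDeriv ℝ 0 (u (-1)) y‖ ≤ ε * s / 4 := by
    intro y hy
    rw [norm_iteratedFDeriv_zero]
    refine hvel hI y ?_
    rw [mem_ball, dist_eq_norm] at hy
    have := norm_sub_norm_le x y
    rw [← norm_neg (x - y), neg_sub] at this
    linarith
  have h2 : ∀ y ∈ ball x (2 * s), ‖iteratedFDeriv ℝ (0 + 2) (u (-1)) y‖ ≤ K₂ :=
    fun y _ => hhess hsol hI (-1) (by norm_num) y
  have key := Literature.Analysis.Calculus.norm_iteratedFDeriv_succ_le_of_bounds hsm hK₂ (k := 0)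
    h0 h2 hs0 (by linarith)
  rw [Nat.zero_add, ChaeWolf.norm_iteratedFDeriv_one_eq_norm_fderiv] at key
  have hsK : s * K₂ ≤ ε / 2 := by
    rw [hs, div_mul_eq_mul_div, div_le_div_iff₀ (by positivity) (by norm_num)]
    nlinarith
  calc ‖fderiv ℝ (u (-1)) x‖ ≤ 2 * (ε * s / 4) / s + s * K₂ := key
    _ = ε / 2 + s * K₂ := by field_simp; ring
    _ ≤ ε := by linarith

/-- ★ **SCALE-INVARIANT FAR-FIELD DECAY OF THE GRADIENT NUMBER.**  For every `C₀ ≥ 0` and `η > 0` there is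
`R > 0` such that every classical Type-I solution of the class satisfies `(0 − s)|∇u(s,y)| ≤ η` whenever
`|y| ≥ R√(0 − s)` (§4 at time `−1`, transported to time `s` by the rescaling `λ = √(0 − s)`).
[folklore; cite: KochNadirashviliSereginSverak2009, §4] -/
theorem typeI_gradNumber_far_decay {C₀ : ℝ} (hC₀ : 0 ≤ C₀) :
    ∀ η : ℝ, 0 < η → ∃ R : ℝ, 0 < R ∧ ∀ {u : ℝ → (EuclideanSpace ℝ (Fin 3)) → (EuclideanSpace ℝ (Fin 3))}
      {p : ℝ → (EuclideanSpace ℝ (Fin 3)) → ℝ},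
      IsClassicalNSSolutionOn (Iio 0) 1 0 u p → HasTypeIDecay C₀ u →
        ∀ s : ℝ, s < 0 → ∀ y : EuclideanSpace ℝ (Fin 3), R * Real.sqrt (0 - s) ≤ ‖y‖ →
          (0 - s) * ‖fderiv ℝ (u s) y‖ ≤ η := by
  intro η hη
  obtain ⟨R, hR⟩ := typeI_grad_decay_unit_time hC₀ η hη
  refine ⟨max R 1, lt_max_of_lt_right one_pos, ?_⟩
  intro u p hsol hI s hs y hy
  obtain ⟨lam, hlam⟩ : ∃ lam : ℝ, lam = Real.sqrt (0 - s) := ⟨_, rfl⟩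
  have hlam0 : 0 < lam := by rw [hlam]; exact Real.sqrt_pos.mpr (by linarith)
  have hlam2 : lam ^ 2 = 0 - s := by rw [hlam, Real.sq_sqrt (by linarith)]
  obtain ⟨hsol', hI'⟩ := typeI_class_nsRescale hlam0 hsol hI
  have hfar : R ≤ ‖lam⁻¹ • y‖ := by
    rw [norm_smul, Real.norm_of_nonneg (inv_nonneg.mpr hlam0.le), inv_mul_eq_div, le_div_iff₀ hlam0]
    rw [← hlam] at hy
    exact ((mul_le_mul_of_nonneg_right (le_max_left R 1) hlam0.le)).trans hy
  have key := hR hsol' hI' (lam⁻¹ • y) hfar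
  have hts : lam ^ 2 * (-1 : ℝ) = s := by rw [hlam2]; ring
  have hxs : lam • lam⁻¹ • y = y := by rw [smul_smul, mul_inv_cancel₀ hlam0.ne', one_smul]
  rw [fderiv_nsRescale, hts, hxs, norm_smul, Real.norm_of_nonneg (sq_nonneg _), hlam2] at key
  exact key

/-! ## §5 The vorticity number is finite; near-records live in a parabolic cone -/

/-- **The vorticity number of a Type-I solution is finite**: `(0 − s)|ω(s,y)| ≤ B(C₀)` (§3 and
`|ω| ≤ ‖curl‖·|∇u|`). [folklore; cite: KochNadirashviliSereginSverak2009, §4] -/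
theorem typeI_vorticityNumber_bound {C₀ : ℝ} (hC₀ : 0 ≤ C₀) :
    ∃ B : ℝ, 0 ≤ B ∧ ∀ {u : ℝ → (EuclideanSpace ℝ (Fin 3)) → (EuclideanSpace ℝ (Fin 3))}
      {p : ℝ → (EuclideanSpace ℝ (Fin 3)) → ℝ},
      IsClassicalNSSolutionOn (Iio 0) 1 0 u p → HasTypeIDecay C₀ u →
        ∀ s : ℝ, s < 0 → ∀ y : EuclideanSpace ℝ (Fin 3), (0 - s) * ‖curl (u s) y‖ ≤ B := by
  obtain ⟨K, hK, hKb⟩ := typeI_grad_clock_bound hC₀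
  obtain ⟨L, hLdef⟩ : ∃ L : ℝ, L = ‖(curlCLM : (EuclideanSpace ℝ (Fin 3) →L[ℝ] EuclideanSpace ℝ (Fin 3)) →L[ℝ]
      EuclideanSpace ℝ (Fin 3))‖ := ⟨_, rfl⟩
  have hL : 0 ≤ L := by rw [hLdef]; exact norm_nonneg _
  refine ⟨L * K, by positivity, ?_⟩
  intro u p hsol hI s hs y
  have h1 : ‖curl (u s) y‖ ≤ L * ‖fderiv ℝ (u s) y‖ := by rw [hLdef]; exact norm_curl_le (u s) y
  calc (0 - s) * ‖curl (u s) y‖ ≤ (0 - s) * (L * ‖fderiv ℝ (u s) y‖) :=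
        mul_le_mul_of_nonneg_left h1 (by linarith)
    _ = L * ((0 - s) * ‖fderiv ℝ (u s) y‖) := by ring
    _ ≤ L * K := mul_le_mul_of_nonneg_left (hKb hsol hI s hs y) hL

/-- ★ **NEAR-RECORDS OF THE VORTICITY NUMBER LIVE IN A PARABOLIC CONE.**  For every `C₀ ≥ 0` and `η > 0` there
is `R > 0` such that for every classical Type-I solution of the class: `(0 − s)|ω(s,y)| ≥ η` forces
`|y| < R√(0 − s)`. [folklore-typed; cite: KochNadirashviliSereginSverak2009, §2 p. 5, §4] -/
theorem typeI_vorticity_nearRecord_cone {C₀ : ℝ} (hC₀ : 0 ≤ C₀) :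
    ∀ η : ℝ, 0 < η → ∃ R : ℝ, 0 < R ∧ ∀ {u : ℝ → (EuclideanSpace ℝ (Fin 3)) → (EuclideanSpace ℝ (Fin 3))}
      {p : ℝ → (EuclideanSpace ℝ (Fin 3)) → ℝ},
      IsClassicalNSSolutionOn (Iio 0) 1 0 u p → HasTypeIDecay C₀ u →
        ∀ s : ℝ, s < 0 → ∀ y : EuclideanSpace ℝ (Fin 3), η ≤ (0 - s) * ‖curl (u s) y‖ →
          ‖y‖ < R * Real.sqrt (0 - s) := by
  intro η hη
  obtain ⟨L, hLdef⟩ : ∃ L : ℝ, L = ‖(curlCLM : (EuclideanSpace ℝ (Fin 3) →L[ℝ] EuclideanSpace ℝ (Fin 3)) →L[ℝ]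
      EuclideanSpace ℝ (Fin 3))‖ := ⟨_, rfl⟩
  have hL : 0 ≤ L := by rw [hLdef]; exact norm_nonneg _
  obtain ⟨R, hR, hfar⟩ := typeI_gradNumber_far_decay hC₀ (η / (2 * (L + 1))) (by positivity)
  refine ⟨R, hR, ?_⟩
  intro u p hsol hI s hs y hyη
  by_contra hy
  push Not at hy
  have h1 : ‖curl (u s) y‖ ≤ L * ‖fderiv ℝ (u s) y‖ := by rw [hLdef]; exact norm_curl_le (u s) y
  have h2 := hfar hsol hI s hs y hy
  have h3 : (0 - s) * ‖curl (u s) y‖ ≤ L * (η / (2 * (L + 1))) :=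
    calc (0 - s) * ‖curl (u s) y‖ ≤ (0 - s) * (L * ‖fderiv ℝ (u s) y‖) :=
          mul_le_mul_of_nonneg_left h1 (by linarith)
      _ = L * ((0 - s) * ‖fderiv ℝ (u s) y‖) := by ring
      _ ≤ L * (η / (2 * (L + 1))) := mul_le_mul_of_nonneg_left h2 hL
  have h4 : L * (η / (2 * (L + 1))) < η := by
    rw [mul_div_assoc', div_lt_iff₀ (by positivity)]
    nlinarith
  linarith

/-! ## §6 The recentred family -/

/-- ★★ **THE RECENTRED FAMILY OF A TYPE-I SOLUTION (KNSS's recentring move, typed for the vorticity number).**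
Let `(u,p)` be a classical solution (`ν = 1`, `f = 0`) on `t < 0` with `HasTypeIDecay C₀ u` and `ω ≢ 0`.  Then
the vorticity number `W* := sup_{s<0,y} (0 − s)|ω(s,y)|` is a positive real number (it bounds `W` and is
approached), and there are scales `λ_j > 0` and points `z_j`, `|z_j| < R`, such that every rescaled solution
`u_j := λ_j u(λ_j²·, λ_j·)` (with pressure `λ_j² p(λ_j²·, λ_j·)`) is again a classical Type-I solution of the same
class (same `C₀`), has vorticity number `≤ W*` everywhere, and almost attains `W*` at the fixed time `−1`:
`W* − W*/(j+2) < |ω_j(−1, z_j)|`.  (The points are bounded because near-records live in the parabolic cone of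
§5; the class gives `u_j` the uniform bounds of KNSS §4.)  The tangent-flow door D14 is the statement that a
pointwise limit of such a family is again a classical Type-I solution.
[folklore-typed; cite: KochNadirashviliSereginSverak2009, §2 p. 5, §4, §6] -/
theorem typeI_recentred_family {C₀ : ℝ}
    {u : ℝ → (EuclideanSpace ℝ (Fin 3)) → (EuclideanSpace ℝ (Fin 3))} {p : ℝ → (EuclideanSpace ℝ (Fin 3)) → ℝ}
    (hsol : IsClassicalNSSolutionOn (Iio 0) 1 0 u p) (hI : HasTypeIDecay C₀ u)
    (hcurl : ∃ t₀ : ℝ, t₀ < 0 ∧ ∃ x₀ : EuclideanSpace ℝ (Fin 3), curl (u t₀) x₀ ≠ 0) :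
    ∃ W R : ℝ, 0 < W ∧ 0 < R ∧
      (∀ s : ℝ, s < 0 → ∀ y : EuclideanSpace ℝ (Fin 3), (0 - s) * ‖curl (u s) y‖ ≤ W) ∧
      (∀ δ : ℝ, 0 < δ → ∃ s : ℝ, s < 0 ∧ ∃ y : EuclideanSpace ℝ (Fin 3),
        W - δ < (0 - s) * ‖curl (u s) y‖) ∧
      ∃ lam : ℕ → ℝ, ∃ z : ℕ → EuclideanSpace ℝ (Fin 3), ∀ j : ℕ,
        0 < lam j ∧ ‖z j‖ < R ∧
        IsClassicalNSSolutionOn (Iio 0) 1 0 (nsRescale (lam j) u) (nsRescalePressure (lam j) p) ∧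
        HasTypeIDecay C₀ (nsRescale (lam j) u) ∧
        (∀ s : ℝ, s < 0 → ∀ y : EuclideanSpace ℝ (Fin 3),
          (0 - s) * ‖curl (nsRescale (lam j) u s) y‖ ≤ W) ∧
        W - W / (j + 2) < ‖curl (nsRescale (lam j) u (-1)) (z j)‖ := by
  have hC₀ : 0 ≤ C₀ := HasTypeIDecay.nonneg' hI
  obtain ⟨B, hB, hBb⟩ := typeI_vorticityNumber_bound hC₀
  obtain ⟨t₀, ht₀, x₀, hω₀⟩ := hcurl
  -- the set of values of the vorticity number and its supremum
  obtain ⟨S, hS⟩ : ∃ S : Set ℝ, S = {w | ∃ s : ℝ, s < 0 ∧ ∃ y : EuclideanSpace ℝ (Fin 3),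
      w = (0 - s) * ‖curl (u s) y‖} := ⟨_, rfl⟩
  have hmem : ∀ s : ℝ, s < 0 → ∀ y : EuclideanSpace ℝ (Fin 3), (0 - s) * ‖curl (u s) y‖ ∈ S :=
    fun s hs y => by rw [hS]; exact ⟨s, hs, y, rfl⟩
  have hne : S.Nonempty := ⟨_, hmem t₀ ht₀ x₀⟩
  have hbdd : BddAbove S := by
    refine ⟨B, fun w hw => ?_⟩
    rw [hS] at hw
    obtain ⟨s, hs, y, rfl⟩ := hw
    exact hBb hsol hI s hs y
  obtain ⟨W, hW⟩ : ∃ W : ℝ, W = sSup S := ⟨_, rfl⟩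
  have hle : ∀ s : ℝ, s < 0 → ∀ y : EuclideanSpace ℝ (Fin 3), (0 - s) * ‖curl (u s) y‖ ≤ W :=
    fun s hs y => by rw [hW]; exact le_csSup hbdd (hmem s hs y)
  have hW0 : 0 < W := by
    have h1 : 0 < (0 - t₀) * ‖curl (u t₀) x₀‖ := mul_pos (by linarith) (norm_pos_iff.mpr hω₀)
    exact lt_of_lt_of_le h1 (hle t₀ ht₀ x₀)
  have happ : ∀ δ : ℝ, 0 < δ → ∃ s : ℝ, s < 0 ∧ ∃ y : EuclideanSpace ℝ (Fin 3),
      W - δ < (0 - s) * ‖curl (u s) y‖ := by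
    intro δ hδ
    obtain ⟨w, hw, hlt⟩ := Real.add_neg_lt_sSup hne (ε := -δ) (by linarith)
    rw [hS] at hw
    obtain ⟨s, hs, y, rfl⟩ := hw
    refine ⟨s, hs, y, ?_⟩
    rw [hW]; linarith
  -- the cone radius for the level `W/2`
  obtain ⟨R, hR, hcone⟩ := typeI_vorticity_nearRecord_cone hC₀ (W / 2) (by positivity)
  -- near-record points, one per `j`
  have hpts : ∀ j : ℕ, ∃ s : ℝ, s < 0 ∧ ∃ y : EuclideanSpace ℝ (Fin 3),
      W - W / (j + 2) < (0 - s) * ‖curl (u s) y‖ :=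
    fun j => happ (W / (j + 2)) (by positivity)
  choose s hs y hy using hpts
  refine ⟨W, R, hW0, hR, hle, happ, fun j => Real.sqrt (0 - s j), fun j => (Real.sqrt (0 - s j))⁻¹ • y j,
    fun j => ?_⟩
  have hsj := hs j
  have hlam0 : 0 < Real.sqrt (0 - s j) := Real.sqrt_pos.mpr (by linarith)
  have hlam2 : Real.sqrt (0 - s j) ^ 2 = 0 - s j := Real.sq_sqrt (by linarith)
  obtain ⟨hsol', hI'⟩ := typeI_class_nsRescale hlam0 hsol hI
  -- the near-record lies in the cone: its level exceeds `W/2`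
  have hlevel : W / 2 ≤ (0 - s j) * ‖curl (u (s j)) (y j)‖ := by
    have h1 : W / (j + 2) ≤ W / 2 := by
      apply div_le_div_of_nonneg_left hW0.le (by norm_num)
      have : (0 : ℝ) ≤ j := Nat.cast_nonneg j
      linarith
    linarith [hy j]
  have hyR : ‖y j‖ < R * Real.sqrt (0 - s j) := hcone hsol hI (s j) hsj (y j) hlevel
  refine ⟨hlam0, ?_, hsol', hI', ?_, ?_⟩
  · rw [norm_smul, Real.norm_of_nonneg (inv_nonneg.mpr hlam0.le), inv_mul_eq_div, div_lt_iff₀ hlam0]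
    exact hyR
  · intro σ hσ w
    rw [vorticityNumber_nsRescale]
    exact hle _ (mul_neg_of_pos_of_neg (by positivity) hσ) _
  · have hts : Real.sqrt (0 - s j) ^ 2 * (-1 : ℝ) = s j := by rw [hlam2]; ring
    have hxs : Real.sqrt (0 - s j) • (Real.sqrt (0 - s j))⁻¹ • y j = y j := by
      rw [smul_smul, mul_inv_cancel₀ hlam0.ne', one_smul]
    have key : (0 - (-1 : ℝ)) * ‖curl (nsRescale (Real.sqrt (0 - s j)) u (-1)) ((Real.sqrt (0 - s j))⁻¹ • y j)‖
        = (0 - s j) * ‖curl (u (s j)) (y j)‖ := by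
      rw [vorticityNumber_nsRescale, hts, hxs]
    have : ‖curl (nsRescale (Real.sqrt (0 - s j)) u (-1)) ((Real.sqrt (0 - s j))⁻¹ • y j)‖
        = (0 - s j) * ‖curl (u (s j)) (y j)‖ := by rw [← key]; ring
    rw [this]
    exact hy j

end Summit.NavierStokesRegularity.NavierStokesRegularity.Theorems.StrainDoors

end
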